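import Summits.AtomisticToContinuum.HydrodynamicLimit.Theses.OneSphereInfluence
import Summits.AtomisticToContinuum.HydrodynamicLimit.Theorems.OneSphereInfluenceAssemblyCore
import Literature.Analysis.FluidPDE.LinearizedHsEulerFamily
import HarnessLib

/-!
# Node «AscoliMeanDoor» beneath crux `ScoreLinearResponse` (stmt-AtomisticToContinuum-13617)

A kernel-checked EXACT split of the crux X_A = `Theses.OneSphereInfluence.ScoreLinearResponse`
(uniform-in-`κ` convergence of the score covariances `Cov_{p_κ^N}(S_κ^N, F_t^N)` to the
`κ`-derivative of the Euler family) into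

* `[M]` `MeanConvergenceOnHull` — under EXACTLY the hypotheses of X_A, for every `κ ∈ [0,1]` the
  MEANS converge: `E_{p_κ^N} F_t^N → ⟨U_κ(t), χ⟩` (density, momentum coordinates, energy).  This is
  the mean half of the hydrodynamic limit in hull-uniform form (no `κ`-derivative, no covariance).
* `[E]` `ScoreResponseEquicontinuityOnPath` — under EXACTLY the hypotheses of X_A, the family
  `κ ↦ Cov_{p_κ^N}(S_κ^N, F_t^N)`, `N ∈ ℕ`, is EQUICONTINUOUS on `[0,1]` (no limit identified).

`scoreLinearResponse_of_mean_of_equicontinuous : [M] → [E] → X_A` (no sorry): the finite-`N` score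
identity `d/dκ E_{p_κ}F = Cov(S_κ,F)` (tree: `hasDerivAt_integral_localGibbsMeasure`), the slope
lemma `tendsto_deriv_of_tendsto_of_equicontinuousWithinAt` below (pointwise convergence of
primitives + equicontinuity of the derivatives at a point + differentiability of the limit primitive
⇒ convergence of the derivatives at that point — an `ε/3` argument through difference quotients, no
Arzelà–Ascoli subsequences), and `equicontinuous + pointwise ⇒ uniform` on the compact `[0,1]`.
(The broad registered birth stub `[E_birth]` — `Cruxes/ScoreLinearResponse/Lines/birth.lean`,
`stub_scoreResponseEquicontinuity` — implies `[E]` by specialisation; that trio lives in the crux line file, not here,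
and the converse bookkeeping lemma «uniform limit of continuous functions is equicontinuous» returns with the converse seams:
critic row 633 ASK (1), landing form L2-MIN.)

Converse seams (why the split is exact): X_A ⇒ [E] (a uniformly convergent sequence of continuous
functions on a compact set is equicontinuous; continuity of each `κ ↦ Cov_{p_κ^N}(S_κ^N,F)` is the
tree's `hasDerivWithinAt_integral_localGibbsLaw (ii)`), and X_A + the `κ = 0` anchor ⇒ [M] (tree:
`tendsto_integral_of_uniform_covariance`, on `[0,κ]` instead of `[0,1]`).  Not re-proved here.

Folklore real analysis + the tree's score calculus; no new definitions of mathematical objects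
(the three `def`s are statement items), no named facts.
-/

noncomputable section

open MeasureTheory ProbabilityTheory Filter Set Topology Real
open scoped InnerProductSpace ENNReal

namespace Summit.AtomisticToContinuum.HydrodynamicLimit.Theorems.AscoliMeanDoor

open Literature.Analysis.FluidPDE Literature.MathematicalPhysics.KineticTheory
open Summit.AtomisticToContinuum.HydrodynamicLimit.Theses.OneSphereInfluence
open Summit.AtomisticToContinuum.HydrodynamicLimit.Theorems.OneSphereInfluenceAssembly

/-! ## Abstract real analysis -/

/-- The infimum of a continuous positive function on the torus is positive (private copy: the tree's
`…HydrodynamicLimit.Theorems.iInf_pos_of_continuous` lives in `OneSphereInfluenceStaticScoreResponsePathData`, whose hub olean is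
not built; importing it would block elaboration). [folklore] -/
private theorem iInf_pos_of_continuous' {f : T3 → ℝ} (hf : Continuous f) (h0 : ∀ x, 0 < f x) : 0 < ⨅ y, f y := by
  obtain ⟨x₀, -, hx₀⟩ := isCompact_univ.exists_isMinOn univ_nonempty hf.continuousOn
  exact lt_of_lt_of_le (h0 x₀) (le_ciInf fun y => hx₀ (mem_univ y))

/-- On a compact set, an equicontinuous family that converges pointwise converges uniformly
(`Equicontinuous.tendsto_uniformFun_iff_pi` on the subtype). [folklore] -/
theorem tendstoUniformlyOn_of_equicontinuousOn {ι X α : Type*} [TopologicalSpace X]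
    [UniformSpace α] {F : ι → X → α} {f : X → α} {K : Set X} {l : Filter ι}
    (hK : IsCompact K) (hF : EquicontinuousOn F K)
    (h : ∀ x ∈ K, Tendsto (fun i => F i x) l (𝓝 (f x))) : TendstoUniformlyOn F f l K := by
  rw [tendstoUniformlyOn_iff_restrict]
  haveI : CompactSpace K := isCompact_iff_compactSpace.mp hK
  have hF' : Equicontinuous (K.restrict ∘ F) := (equicontinuous_restrict_iff F).mpr hF
  have hpt : Tendsto (K.restrict ∘ F) l (𝓝 (K.restrict f)) :=
    tendsto_pi_nhds.mpr fun x => h x x.2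
  have key := (hF'.tendsto_uniformFun_iff_pi l (K.restrict f)).mpr hpt
  exact UniformFun.tendsto_iff_tendstoUniformly.mp key

/-- **Slope lemma.** On `[0,1]`: if the primitives `f_N` (continuous on `[0,1]`, derivative `g_N`
in the interior, `g_N` continuous on `[0,1]`) converge pointwise to `c`, the derivatives `g_N` are
equicontinuous within `[0,1]` at `κ`, and `c` has derivative `c'` within `[0,1]` at `κ`, then
`g_N(κ) → c'`.  Proof: for `s ≠ κ` close to `κ`, `|slope f_N κ s - g_N κ| ≤ ε/3` uniformly in `N`
(mean of `g_N` over `[κ,s]`), `slope f_N κ s → slope c κ s` (`N → ∞`), `|slope c κ s - c'| < ε/3`.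
[folklore] -/
theorem tendsto_deriv_of_tendsto_of_equicontinuousWithinAt {f g : ℕ → ℝ → ℝ} {c : ℝ → ℝ}
    {c' κ : ℝ} (hκ : κ ∈ Icc (0 : ℝ) 1)
    (hfc : ∀ N, ContinuousOn (f N) (Icc 0 1))
    (hfd : ∀ N, ∀ s ∈ Ioo (0 : ℝ) 1, HasDerivAt (f N) (g N s) s)
    (hgc : ∀ N, ContinuousOn (g N) (Icc 0 1))
    (hE : EquicontinuousWithinAt g (Icc 0 1) κ)
    (hM : ∀ s ∈ Icc (0 : ℝ) 1, Tendsto (fun N => f N s) atTop (𝓝 (c s)))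
    (hc : HasDerivWithinAt c c' (Icc 0 1) κ) :
    Tendsto (fun N => g N κ) atTop (𝓝 c') := by
  rw [Metric.tendsto_atTop]
  intro ε hε
  have hε3 : 0 < ε / 3 := by positivity
  -- (1) equicontinuity of the `g_N` at `κ`: radius `r₁`
  have h1 : ∀ᶠ s in 𝓝[Icc 0 1] κ, ∀ N, dist (g N κ) (g N s) < ε / 3 :=
    hE _ (Metric.dist_mem_uniformity hε3)
  obtain ⟨r₁, hr₁, hball₁⟩ := Metric.mem_nhdsWithin_iff.1 h1
  -- (2) the difference quotients of `c` at `κ`: radius `r₂`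
  have h2 : Tendsto (slope c κ) (𝓝[Icc 0 1 \ {κ}] κ) (𝓝 c') :=
    hasDerivWithinAt_iff_tendsto_slope.1 hc
  have h2' : ∀ᶠ s in 𝓝[Icc 0 1 \ {κ}] κ, dist (slope c κ s) c' < ε / 3 :=
    (Metric.tendsto_nhds.1 h2) _ hε3
  obtain ⟨r₂, hr₂, hball₂⟩ := Metric.mem_nhdsWithin_iff.1 h2'
  -- (3) a point `s ≠ κ` of `[0,1]` within both radii
  obtain ⟨s, hsI, hsκ, hsd⟩ : ∃ s ∈ Icc (0 : ℝ) 1, s ≠ κ ∧ dist s κ < min r₁ r₂ := by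
    have hr : 0 < min r₁ r₂ := lt_min hr₁ hr₂
    set δ : ℝ := min (min r₁ r₂ / 2) (1 / 2) with hδ
    have hδpos : 0 < δ := by positivity
    have hδr : δ < min r₁ r₂ := lt_of_le_of_lt (min_le_left _ _) (by linarith)
    have hδh : δ ≤ 1 / 2 := min_le_right _ _
    by_cases h : κ + δ ≤ 1
    · refine ⟨κ + δ, ⟨by linarith [hκ.1], h⟩, by linarith, ?_⟩
      rw [Real.dist_eq, show κ + δ - κ = δ by ring, abs_of_pos hδpos]
      exact hδr
    · have h' : 1 < κ + δ := not_le.1 h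
      refine ⟨κ - δ, ⟨by linarith [hκ.2], by linarith [hκ.2]⟩, by linarith, ?_⟩
      rw [Real.dist_eq, show κ - δ - κ = -δ by ring, abs_neg, abs_of_pos hδpos]
      exact hδr
  have hsub : uIcc κ s ⊆ Icc 0 1 := uIcc_subset_Icc hκ hsI
  -- (4) on the segment `[κ, s]`, `g_N` is within `ε/3` of `g_N κ`, uniformly in `N`
  have hseg : ∀ N, ∀ x ∈ uIcc κ s, dist (g N κ) (g N x) < ε / 3 := by
    intro N x hx
    have hxd : dist x κ < r₁ :=
      calc dist x κ = |x - κ| := Real.dist_eq _ _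
        _ ≤ |s - κ| := abs_sub_left_of_mem_uIcc hx
        _ = dist s κ := (Real.dist_eq _ _).symm
        _ < r₁ := hsd.trans_le (min_le_left _ _)
    exact hball₁ ⟨hxd, hsub hx⟩ N
  -- (5) the difference quotient of `c` at `s`
  have hslope_c : dist (slope c κ s) c' < ε / 3 := by
    have hs' : s ∈ Metric.ball κ r₂ ∩ (Icc 0 1 \ {κ}) :=
      ⟨hsd.trans_le (min_le_right _ _), hsI, fun h => hsκ (mem_singleton_iff.1 h)⟩
    exact hball₂ hs'
  -- (6) FTC for `f_N` between `κ` and `s`, and the slope estimate, uniformly in `N`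
  have hFTC : ∀ N, f N s - f N κ = ∫ x in κ..s, g N x := by
    intro N
    rcases lt_or_gt_of_ne hsκ with h | h
    · have h' := intervalIntegral.integral_eq_sub_of_hasDerivAt_of_le h.le
        ((hfc N).mono (Icc_subset_Icc hsI.1 hκ.2))
        (fun x hx => hfd N x ⟨hsI.1.trans_lt hx.1, hx.2.trans_le hκ.2⟩)
        (((hgc N).mono (Icc_subset_Icc hsI.1 hκ.2)).intervalIntegrable_of_Icc h.le)
      rw [intervalIntegral.integral_symm, h']
      ring
    · have h' := intervalIntegral.integral_eq_sub_of_hasDerivAt_of_le h.le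
        ((hfc N).mono (Icc_subset_Icc hκ.1 hsI.2))
        (fun x hx => hfd N x ⟨hκ.1.trans_lt hx.1, hx.2.trans_le hsI.2⟩)
        (((hgc N).mono (Icc_subset_Icc hκ.1 hsI.2)).intervalIntegrable_of_Icc h.le)
      rw [h']
  have hsκ0 : s - κ ≠ 0 := sub_ne_zero.2 hsκ
  have habs : 0 < |s - κ| := abs_pos.2 hsκ0
  have hest : ∀ N, |slope (f N) κ s - g N κ| ≤ ε / 3 := by
    intro N
    have hint : IntervalIntegrable (g N) volume κ s := ((hgc N).mono hsub).intervalIntegrable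
    have hkey : slope (f N) κ s - g N κ = (s - κ)⁻¹ * ∫ x in κ..s, (g N x - g N κ) := by
      rw [slope_def_field, hFTC N, intervalIntegral.integral_sub hint intervalIntegrable_const,
        intervalIntegral.integral_const, smul_eq_mul]
      field_simp
    have hbound : ‖∫ x in κ..s, (g N x - g N κ)‖ ≤ (ε / 3) * |s - κ| :=
      intervalIntegral.norm_integral_le_of_norm_le_const fun x hx => by
        rw [Real.norm_eq_abs, ← Real.dist_eq, dist_comm]
        exact (hseg N x (uIoc_subset_uIcc hx)).le
    rw [Real.norm_eq_abs] at hbound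
    rw [hkey, abs_mul, abs_inv]
    calc |s - κ|⁻¹ * |∫ x in κ..s, (g N x - g N κ)| ≤ |s - κ|⁻¹ * (ε / 3 * |s - κ|) := by
          gcongr
      _ = ε / 3 := by field_simp
  -- (7) the difference quotients of the `f_N` converge to that of `c`
  have hsl : Tendsto (fun N => slope (f N) κ s) atTop (𝓝 (slope c κ s)) := by
    simp only [slope_def_field]
    exact ((hM s hsI).sub (hM κ hκ)).div_const _
  obtain ⟨N₀, hN₀⟩ := (Metric.tendsto_atTop.1 hsl) (ε / 3) hε3
  refine ⟨N₀, fun N hN => ?_⟩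
  have hA := hN₀ N hN
  rw [Real.dist_eq] at hA hslope_c ⊢
  have hB := hest N
  rw [abs_sub_comm] at hB
  have hsplit : g N κ - c' = (g N κ - slope (f N) κ s) + ((slope (f N) κ s - slope c κ s) +
      (slope c κ s - c')) := by ring
  rw [hsplit]
  calc |(g N κ - slope (f N) κ s) + ((slope (f N) κ s - slope c κ s) + (slope c κ s - c'))|
        ≤ |g N κ - slope (f N) κ s| + (|slope (f N) κ s - slope c κ s| + |slope c κ s - c'|) :=
        (abs_add_le _ _).trans (add_le_add le_rfl (abs_add_le _ _))
    _ < ε := by linarith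

/-! ## The score-covariance instance along a smooth path of profiles -/

section Path

variable {a θ₀ : ℝ → T3 → ℝ} {u₀ : ℝ → T3 → V3}
  (ha : Literature.Analysis.FunctionSpaces.Torus.IsSmoothSpaceTimeOn (Icc 0 1) a)
  (hθ : Literature.Analysis.FunctionSpaces.Torus.IsSmoothSpaceTimeOn (Icc 0 1) θ₀)
  (hu : Literature.Analysis.FunctionSpaces.Torus.IsSmoothSpaceTimeOn (Icc 0 1) u₀)
  (ha0 : ∀ κ ∈ Icc (0 : ℝ) 1, ∀ x, 0 < a κ x) (hθ0 : ∀ κ ∈ Icc (0 : ℝ) 1, ∀ x, 0 < θ₀ κ x)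
  (σ : ℝ)

include ha hθ hu ha0 hθ0 in
/-- **Mean convergence + equicontinuity of the score covariances ⇒ uniform score linear response**
(one abstract energy-dominated observable).  Along a jointly smooth path of positive profiles whose
local Gibbs laws are probability measures: if `E_{p_κ^N} F_N → G(κ)` for every `κ ∈ [0,1]`, `G` is
differentiable within `[0,1]`, and `{κ ↦ Cov_{p_κ^N}(S_κ^N, F_N)}_N` is equicontinuous on `[0,1]`,
then `Cov_{p_κ^N}(S_κ^N, F_N) → G'(κ)` uniformly on `[0,1]` (finite-`N` score identity, the slope
lemma, equicontinuous + pointwise ⇒ uniform on the compact interval). [folklore] -/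
theorem tendstoUniformlyOn_cov_of_tendsto_integral
    (Φ : (N : ℕ) → HardSphereFlow (Torus.geometry (Fin 3)) (hsDiameter σ N) (N + 1))
    (hprob : ∀ κ ∈ Icc (0 : ℝ) 1, ∀ N, IsProbabilityMeasure (localGibbsMeasure σ (a κ) (u₀ κ) (θ₀ κ) N))
    {F : (N : ℕ) → Config (N + 1) (Fin 3) T3 → ℝ} (hFm : ∀ N, Measurable (F N)) {K : ℝ} (hK : 0 ≤ K)
    (hFb : ∀ N, ∀ z ∈ (Φ N).good, |F N z| ≤ K * (1 + ((N + 1 : ℕ) : ℝ)⁻¹ * ∑ i, ‖(z i).2‖ ^ 2))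
    {G : ℝ → ℝ} (hG : ∀ κ ∈ Icc (0 : ℝ) 1, DifferentiableWithinAt ℝ G (Icc 0 1) κ)
    (hmean : ∀ κ ∈ Icc (0 : ℝ) 1,
      Tendsto (fun N => ∫ z, F N z ∂localGibbsMeasure σ (a κ) (u₀ κ) (θ₀ κ) N) atTop (𝓝 (G κ)))
    (hequi : EquicontinuousOn (fun N κ => cov[fun z => ∑ i,
        derivWithin (fun κ' => Real.log (localGibbsProfile (a κ') (u₀ κ') (θ₀ κ') (z i))) (Icc 0 1) κ, F N;
        localGibbsMeasure σ (a κ) (u₀ κ) (θ₀ κ) N]) (Icc (0 : ℝ) 1)) :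
    TendstoUniformlyOn (fun N κ => cov[fun z => ∑ i,
        derivWithin (fun κ' => Real.log (localGibbsProfile (a κ') (u₀ κ') (θ₀ κ') (z i))) (Icc 0 1) κ, F N;
        localGibbsMeasure σ (a κ) (u₀ κ) (θ₀ κ) N])
      (fun κ => derivWithin G (Icc 0 1) κ) atTop (Icc 0 1) := by
  have hFb' := fun N => ae_abs_le_of_good σ (Φ N) hK (hFb N)
  have hprob' : ∀ N, ∀ κ ∈ Icc (0 : ℝ) 1, IsProbabilityMeasure (localGibbsMeasure σ (a κ) (u₀ κ) (θ₀ κ) N) :=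
    fun N κ hκ => hprob κ hκ N
  have hderiv : ∀ N, ∀ κ ∈ Ioo (0 : ℝ) 1,
      HasDerivAt (fun κ' => ∫ z, F N z ∂localGibbsMeasure σ (a κ') (u₀ κ') (θ₀ κ') N)
        (cov[fun z => ∑ i, derivWithin (fun κ' => Real.log (localGibbsProfile (a κ') (u₀ κ') (θ₀ κ') (z i)))
          (Icc 0 1) κ, F N; localGibbsMeasure σ (a κ) (u₀ κ) (θ₀ κ) N]) κ := fun N κ hκ =>
    hasDerivAt_integral_localGibbsMeasure ha hθ hu ha0 hθ0 σ N (hprob' N) (hFm N) hK (hFb' N) hκ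
  have hcont : ∀ N, ContinuousOn (fun κ' => ∫ z, F N z ∂localGibbsMeasure σ (a κ') (u₀ κ') (θ₀ κ') N)
      (Icc 0 1) := fun N =>
    continuousOn_integral_localGibbsMeasure ha hθ hu ha0 hθ0 σ N (hprob' N) (hFm N) hK (hFb' N)
  have hgc : ∀ N, ContinuousOn (fun κ => cov[fun z => ∑ i,
      derivWithin (fun κ' => Real.log (localGibbsProfile (a κ') (u₀ κ') (θ₀ κ') (z i))) (Icc 0 1) κ, F N;
      localGibbsMeasure σ (a κ) (u₀ κ) (θ₀ κ) N]) (Icc 0 1) := fun N => hequi.continuousOn N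
  refine tendstoUniformlyOn_of_equicontinuousOn isCompact_Icc hequi fun κ hκ => ?_
  exact tendsto_deriv_of_tendsto_of_equicontinuousWithinAt hκ hcont hderiv hgc (hequi κ hκ) hmean
    (hG κ hκ).hasDerivWithinAt

end Path

/-! ## The two pieces (statement items) -/

/-- **[M] Mean convergence on the hull** (COSTUME tag: the MEAN half of the hydrodynamic limit, in
hull-uniform form).  Under exactly the hypotheses of `ScoreLinearResponse` — target profile, `Λ`-hull,
`σ < σ₀(profile, Λ)`, a smooth path of profiles inside the hull from a constant state to the target,
a jointly smooth family of classical hard-sphere Euler solutions on `[0,T)` matched at `t = 0` by the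
law of large numbers under the local Gibbs laws `p_κ^N` — for every `κ ∈ [0,1]`, `t < T` and
continuous `χ`: `E_{p_κ^N} ⟨ρ_N(t),χ⟩ → ∫ χ ρ_κ(t)`, `E_{p_κ^N} ⟨m_N(t),χ⟩_j → ∫ χ ρ_κ u_{κ,j}(t)`,
`E_{p_κ^N} ⟨e_N(t),χ⟩ → ∫ χ e(ρ_κ,u_κ,θ_κ)(t)`.  Strictly weaker than the crux (identifies no
`κ`-derivative); on the summit ladder (it follows from the hydrodynamic limit with `σ₀` uniform over
the `Λ`-hull, by uniform integrability). [difficulty: open-problem] [piece] -/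
def MeanConvergenceOnHull : Prop :=
  ∀ (a₁ θ₁ : Literature.MathematicalPhysics.KineticTheory.T3 → ℝ) (u₁ : Literature.MathematicalPhysics.KineticTheory.T3 → Literature.MathematicalPhysics.KineticTheory.V3), Continuous a₁ → Continuous θ₁ → Continuous u₁ → (∀ x, 0 < a₁ x) → (∀ x, 0 < θ₁ x) → ∀ Λ : ℝ, 1 ≤ Λ → ∃ σ₀ : ℝ, 0 < σ₀ ∧ ∀ σ : ℝ, 0 < σ → σ < σ₀ → ∀ (a θ₀ : ℝ → Literature.MathematicalPhysics.KineticTheory.T3 → ℝ) (u₀ : ℝ → Literature.MathematicalPhysics.KineticTheory.T3 → Literature.MathematicalPhysics.KineticTheory.V3), Literature.Analysis.FunctionSpaces.Torus.IsSmoothSpaceTimeOn (Set.Icc 0 1) a → Literature.Analysis.FunctionSpaces.Torus.IsSmoothSpaceTimeOn (Set.Icc 0 1) θ₀ → Literature.Analysis.FunctionSpaces.Torus.IsSmoothSpaceTimeOn (Set.Icc 0 1) u₀ → (∀ κ ∈ Set.Icc (0 : ℝ) 1, ∀ x, Λ⁻¹ * (⨅ y, a₁ y) ≤ a κ x ∧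 a κ x ≤ Λ * (⨆ y, a₁ y) ∧ 0 < θ₀ κ x) → (∀ x, a 0 x = a 0 0 ∧ θ₀ 0 x = θ₀ 0 0 ∧ u₀ 0 x = u₀ 0 0) → a 1 = a₁ → θ₀ 1 = θ₁ → u₀ 1 = u₁ → ∀ (T : ℝ) (ρ θ : ℝ → ℝ → Literature.MathematicalPhysics.KineticTheory.T3 → ℝ) (u : ℝ → ℝ → Literature.MathematicalPhysics.KineticTheory.T3 → Literature.MathematicalPhysics.KineticTheory.V3), (∀ κ ∈ Set.Icc (0 : ℝ) 1, Literature.MathematicalPhysics.KineticTheory.IsHardSphereEulerSolution σ T (ρ κ) (u κ) (θ κ)) → ContDiffOn ℝ ((⊤ : ℕ∞) : WithTop ℕ∞) (fun q : ℝ × ℝ × EuclideanSpace ℝ (Fin 3) => ρ q.1 q.2.1 (Literature.Analysis.FunctionSpaces.Torus.proj q.2.2)) (Set.Icc 0 1 ×ˢ (Set.Ico 0 T ×ˢ Set.univ)) → ContDiffOn ℝ ((⊤ : ℕ∞) : WithTop ℕ∞) (fun q : ℝ × ℝ × EuclideanSpace ℝ (Fin 3) => u q.1 q.2.1 (Literature.Analysis.FunctionSpaces.Torus.proj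 q.2.2)) (Set.Icc 0 1 ×ˢ (Set.Ico 0 T ×ˢ Set.univ)) → ContDiffOn ℝ ((⊤ : ℕ∞) : WithTop ℕ∞) (fun q : ℝ × ℝ × EuclideanSpace ℝ (Fin 3) => θ q.1 q.2.1 (Literature.Analysis.FunctionSpaces.Torus.proj q.2.2)) (Set.Icc 0 1 ×ˢ (Set.Ico 0 T ×ˢ Set.univ)) → ∀ Φ : (N : ℕ) → Literature.Analysis.FluidPDE.HardSphereFlow (Literature.Analysis.FluidPDE.Torus.geometry (Fin 3)) (Literature.MathematicalPhysics.KineticTheory.hsDiameter σ N) (N + 1), (∀ κ ∈ Set.Icc (0 : ℝ) 1, Literature.MathematicalPhysics.KineticTheory.TendstoHydroFieldsAt (fun N => Literature.MathematicalPhysics.KineticTheory.localGibbsLaw σ (a κ) (u₀ κ) (θ₀ κ) N (Φ N)) Φ (ρ κ) (u κ) (θ κ) 0) → ∀ t ∈ Set.Ico 0 T, ∀ χ : Literature.MathematicalPhysics.KineticTheory.T3 → ℝ, Continuous χ → let p : ℝ → (N : ℕ) → MeasureTheory.Measure (Literature.Analysis.FluidPDE.Config (N + 1) (Fin 3) Literature.MathematicalPhysics.KineticTheory.T3)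 := fun κ N => Literature.MathematicalPhysics.KineticTheory.localGibbsLaw σ (a κ) (u₀ κ) (θ₀ κ) N (Φ N); (∀ κ ∈ Set.Icc (0 : ℝ) 1, Filter.Tendsto (fun N : ℕ => ∫ z, Literature.MathematicalPhysics.KineticTheory.empiricalDensityField ((Φ N).flow t z) χ ∂(p κ N)) Filter.atTop (nhds (∫ x, χ x * ρ κ t x))) ∧ (∀ j : Fin 3, ∀ κ ∈ Set.Icc (0 : ℝ) 1, Filter.Tendsto (fun N : ℕ => ∫ z, Literature.MathematicalPhysics.KineticTheory.empiricalMomentumField ((Φ N).flow t z) χ j ∂(p κ N)) Filter.atTop (nhds (∫ x, χ x * ρ κ t x * u κ t x j))) ∧ (∀ κ ∈ Set.Icc (0 : ℝ) 1, Filter.Tendsto (fun N : ℕ => ∫ z, Literature.MathematicalPhysics.KineticTheory.empiricalEnergyField ((Φ N).flow t z) χ ∂(p κ N)) Filter.atTop (nhds (∫ x, χ x * Literature.MathematicalPhysics.KineticTheory.totalEnergyDensity (ρ κ t x) (u κ t x) (θ κ t x))))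

/-- **[E] Equicontinuity of the score covariances on the path** (WEAKER-than-crux tag: implied by the
crux, identifies no limit).  Under exactly the hypotheses of `ScoreLinearResponse`, for `t < T` and
continuous `χ`, the family of functions `κ ↦ Cov_{p_κ^N}(S_κ^N, F_t^N)`, `N ∈ ℕ`
(`S_κ^N = ∑ᵢ ∂_κ log f_κ(zᵢ)`; `F_t^N` = tested empirical density / momentum coordinate / energy at
time `t`), is equicontinuous on `[0,1]`.  Each member is continuous (tree:
`hasDerivWithinAt_integral_localGibbsLaw`); the content is UNIFORMITY IN `N` of the `κ`-modulus of a
size-`O(1)` response = `O(√N) × O(N^{-1/2})` covariance — a dynamic `κ`-regularity statement about the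
`N`-sphere flow from local-equilibrium data, open. [difficulty: open-problem] [piece] -/
def ScoreResponseEquicontinuityOnPath : Prop :=
  ∀ (a₁ θ₁ : Literature.MathematicalPhysics.KineticTheory.T3 → ℝ) (u₁ : Literature.MathematicalPhysics.KineticTheory.T3 → Literature.MathematicalPhysics.KineticTheory.V3), Continuous a₁ → Continuous θ₁ → Continuous u₁ → (∀ x, 0 < a₁ x) → (∀ x, 0 < θ₁ x) → ∀ Λ : ℝ, 1 ≤ Λ → ∃ σ₀ : ℝ, 0 < σ₀ ∧ ∀ σ : ℝ, 0 < σ → σ < σ₀ → ∀ (a θ₀ : ℝ → Literature.MathematicalPhysics.KineticTheory.T3 → ℝ) (u₀ : ℝ → Literature.MathematicalPhysics.KineticTheory.T3 → Literature.MathematicalPhysics.KineticTheory.V3), Literature.Analysis.FunctionSpaces.Torus.IsSmoothSpaceTimeOn (Set.Icc 0 1) a → Literature.Analysis.FunctionSpaces.Torus.IsSmoothSpaceTimeOn (Set.Icc 0 1) θ₀ → Literature.Analysis.FunctionSpaces.Torus.IsSmoothSpaceTimeOn (Set.Icc 0 1) u₀ → (∀ κ ∈ Set.Icc (0 : ℝ)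 1, ∀ x, Λ⁻¹ * (⨅ y, a₁ y) ≤ a κ x ∧ a κ x ≤ Λ * (⨆ y, a₁ y) ∧ 0 < θ₀ κ x) → (∀ x, a 0 x = a 0 0 ∧ θ₀ 0 x = θ₀ 0 0 ∧ u₀ 0 x = u₀ 0 0) → a 1 = a₁ → θ₀ 1 = θ₁ → u₀ 1 = u₁ → ∀ (T : ℝ) (ρ θ : ℝ → ℝ → Literature.MathematicalPhysics.KineticTheory.T3 → ℝ) (u : ℝ → ℝ → Literature.MathematicalPhysics.KineticTheory.T3 → Literature.MathematicalPhysics.KineticTheory.V3), (∀ κ ∈ Set.Icc (0 : ℝ) 1, Literature.MathematicalPhysics.KineticTheory.IsHardSphereEulerSolution σ T (ρ κ) (u κ) (θ κ)) → ContDiffOn ℝ ((⊤ : ℕ∞) : WithTop ℕ∞) (fun q : ℝ × ℝ × EuclideanSpace ℝ (Fin 3) => ρ q.1 q.2.1 (Literature.Analysis.FunctionSpaces.Torus.proj q.2.2)) (Set.Icc 0 1 ×ˢ (Set.Ico 0 T ×ˢ Set.univ)) → ContDiffOn ℝ ((⊤ : ℕ∞) : WithTop ℕ∞) (fun q : ℝ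 × ℝ × EuclideanSpace ℝ (Fin 3) => u q.1 q.2.1 (Literature.Analysis.FunctionSpaces.Torus.proj q.2.2)) (Set.Icc 0 1 ×ˢ (Set.Ico 0 T ×ˢ Set.univ)) → ContDiffOn ℝ ((⊤ : ℕ∞) : WithTop ℕ∞) (fun q : ℝ × ℝ × EuclideanSpace ℝ (Fin 3) => θ q.1 q.2.1 (Literature.Analysis.FunctionSpaces.Torus.proj q.2.2)) (Set.Icc 0 1 ×ˢ (Set.Ico 0 T ×ˢ Set.univ)) → ∀ Φ : (N : ℕ) → Literature.Analysis.FluidPDE.HardSphereFlow (Literature.Analysis.FluidPDE.Torus.geometry (Fin 3)) (Literature.MathematicalPhysics.KineticTheory.hsDiameter σ N) (N + 1), (∀ κ ∈ Set.Icc (0 : ℝ) 1, Literature.MathematicalPhysics.KineticTheory.TendstoHydroFieldsAt (fun N => Literature.MathematicalPhysics.KineticTheory.localGibbsLaw σ (a κ) (u₀ κ) (θ₀ κ) N (Φ N)) Φ (ρ κ) (u κ) (θ κ) 0) → ∀ t ∈ Set.Ico 0 T, ∀ χ : Literature.MathematicalPhysics.KineticTheory.T3 → ℝ, Continuous χ →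 let p : ℝ → (N : ℕ) → MeasureTheory.Measure (Literature.Analysis.FluidPDE.Config (N + 1) (Fin 3) Literature.MathematicalPhysics.KineticTheory.T3) := fun κ N => Literature.MathematicalPhysics.KineticTheory.localGibbsLaw σ (a κ) (u₀ κ) (θ₀ κ) N (Φ N); let S : ℝ → (N : ℕ) → Literature.Analysis.FluidPDE.Config (N + 1) (Fin 3) Literature.MathematicalPhysics.KineticTheory.T3 → ℝ := fun κ _ z => ∑ i, derivWithin (fun κ' => Real.log (Literature.MathematicalPhysics.KineticTheory.localGibbsProfile (a κ') (u₀ κ') (θ₀ κ') (z i))) (Set.Icc 0 1) κ; EquicontinuousOn (fun (N : ℕ) (κ : ℝ) => ProbabilityTheory.covariance (S κ N) (fun z => Literature.MathematicalPhysics.KineticTheory.empiricalDensityField ((Φ N).flow t z) χ) (p κ N)) (Set.Icc (0 : ℝ) 1) ∧ (∀ j : Fin 3, EquicontinuousOn (fun (N : ℕ) (κ : ℝ) => ProbabilityTheory.covariance (S κ N) (fun z => Literature.MathematicalPhysics.KineticTheory.empiricalMomentumField ((Φ N).flow t z) χ j) (p κ N)) (Set.Icc (0 : ℝ) 1)) ∧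 EquicontinuousOn (fun (N : ℕ) (κ : ℝ) => ProbabilityTheory.covariance (S κ N) (fun z => Literature.MathematicalPhysics.KineticTheory.empiricalEnergyField ((Φ N).flow t z) χ) (p κ N)) (Set.Icc (0 : ℝ) 1)

/-! ## The composition: `[M] → [E] → ScoreLinearResponse` -/

/-- **Node «AscoliMeanDoor»**: mean convergence on the hull and equicontinuity of the score
covariances on the path imply the crux `ScoreLinearResponse` (route `OneSphereInfluence`,
stmt-AtomisticToContinuum-13617), BY NAME.  `σ₀ := min (min σ_M σ_E) (1/2)`; field by field through
`tendstoUniformlyOn_cov_of_tendsto_integral` (the limit `G(κ) = ∫ χ U_κ(t)_k` is differentiable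
within `[0,1]` by `hasDerivWithinAt_integral_mul_consState_apply`). [folklore] -/
theorem scoreLinearResponse_of_mean_of_equicontinuous :
    MeanConvergenceOnHull → ScoreResponseEquicontinuityOnPath →
      Summit.AtomisticToContinuum.HydrodynamicLimit.Theses.OneSphereInfluence.ScoreLinearResponse := by
  intro hM hE a₁ θ₁ u₁ ha₁ hθ₁ hu₁ ha₁0 hθ₁0 Λ hΛ
  obtain ⟨σM, hσM, hMσ⟩ := hM a₁ θ₁ u₁ ha₁ hθ₁ hu₁ ha₁0 hθ₁0 Λ hΛ
  obtain ⟨σE, hσE, hEσ⟩ := hE a₁ θ₁ u₁ ha₁ hθ₁ hu₁ ha₁0 hθ₁0 Λ hΛ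
  refine ⟨min (min σM σE) (1 / 2), lt_min (lt_min hσM hσE) one_half_pos, ?_⟩
  intro σ hσ hσlt a θ₀ u₀ ha hθs hus hhull hconst ha1 hθ1 hu1 T ρ θ u hsols hρc huc hθc Φ hlln t ht χ hχ
  have hσM' : σ < σM := lt_of_lt_of_le hσlt ((min_le_left _ _).trans (min_le_left _ _))
  have hσE' : σ < σE := lt_of_lt_of_le hσlt ((min_le_left _ _).trans (min_le_right _ _))
  have hσ2 : σ ≤ 1 / 2 := (hσlt.trans_le (min_le_right _ _)).le
  have hMt := hMσ σ hσ hσM' a θ₀ u₀ ha hθs hus hhull hconst ha1 hθ1 hu1 T ρ θ u hsols hρc huc hθc Φ hlln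
    t ht χ hχ
  have hEt := hEσ σ hσ hσE' a θ₀ u₀ ha hθs hus hhull hconst ha1 hθ1 hu1 T ρ θ u hsols hρc huc hθc Φ hlln
    t ht χ hχ
  dsimp only at hMt hEt ⊢
  obtain ⟨hMd, hMm, hMe⟩ := hMt
  obtain ⟨hEd, hEm, hEe⟩ := hEt
  -- positivity of the path profiles, probability of the local Gibbs laws
  have hinf : 0 < Λ⁻¹ * ⨅ y, a₁ y :=
    mul_pos (inv_pos.2 (zero_lt_one.trans_le hΛ)) (iInf_pos_of_continuous' ha₁ ha₁0)
  have ha0 : ∀ κ ∈ Icc (0 : ℝ) 1, ∀ x, 0 < a κ x := fun κ hκ x => hinf.trans_le (hhull κ hκ x).1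
  have hθ0 : ∀ κ ∈ Icc (0 : ℝ) 1, ∀ x, 0 < θ₀ κ x := fun κ hκ x => (hhull κ hκ x).2.2
  have hprobM : ∀ κ ∈ Icc (0 : ℝ) 1, ∀ N, IsProbabilityMeasure (localGibbsMeasure σ (a κ) (u₀ κ) (θ₀ κ) N) := by
    intro κ hκ N
    obtain ⟨hac, hθc', huc'⟩ := continuous_slices ha hθs hus hκ
    rw [← localGibbsLaw_eq σ _ _ _ N (Φ N)]
    exact isProbabilityMeasure_localGibbsLaw hac hθc' huc' (ha0 κ hκ) (hθ0 κ hκ) hσ2 N (Φ N)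
  obtain ⟨Cχ, hCχ0, hCχ⟩ := exists_forall_abs_le_of_continuous hχ
  simp_rw [localGibbsLaw_eq] at hMd hMm hMe hEd hEm hEe ⊢
  -- the common core, for one scalar observable
  have core : ∀ (F₀ : (N : ℕ) → Config (N + 1) (Fin 3) T3 → ℝ) (G : ℝ → ℝ) (k : Fin 5),
      (∀ N, Continuous (F₀ N)) →
      (∀ N, ∀ z ∈ (Φ N).good, |F₀ N ((Φ N).flow t z)| ≤ Cχ * (1 + (((N + 1 : ℕ) : ℝ))⁻¹ * ∑ i, ‖(z i).2‖ ^ 2)) →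
      (∀ κ, G κ = ∫ x, χ x * (consState (ρ κ t x) (u κ t x) (θ κ t x)) k) →
      (∀ κ ∈ Icc (0 : ℝ) 1, Tendsto (fun N => ∫ z, F₀ N ((Φ N).flow t z)
        ∂localGibbsMeasure σ (a κ) (u₀ κ) (θ₀ κ) N) atTop (𝓝 (G κ))) →
      EquicontinuousOn (fun N κ => cov[fun z => ∑ i, derivWithin
          (fun κ' => Real.log (localGibbsProfile (a κ') (u₀ κ') (θ₀ κ') (z i))) (Icc 0 1) κ,
          fun z => F₀ N ((Φ N).flow t z); localGibbsMeasure σ (a κ) (u₀ κ) (θ₀ κ) N]) (Icc (0 : ℝ) 1) →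
      TendstoUniformlyOn (fun N κ => cov[fun z => ∑ i, derivWithin
          (fun κ' => Real.log (localGibbsProfile (a κ') (u₀ κ') (θ₀ κ') (z i))) (Icc 0 1) κ,
          fun z => F₀ N ((Φ N).flow t z); localGibbsMeasure σ (a κ) (u₀ κ) (θ₀ κ) N])
        (fun κ => derivWithin G (Icc 0 1) κ) atTop (Icc 0 1) := by
    intro F₀ G k hF₀c hFb hGeq hmean hequi
    have hFm : ∀ N, Measurable fun z => F₀ N ((Φ N).flow t z) := fun N =>
      (hF₀c N).measurable.comp ((Φ N).measurable_flow t)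
    have hG : ∀ κ ∈ Icc (0 : ℝ) 1, DifferentiableWithinAt ℝ G (Icc 0 1) κ := by
      intro κ hκ
      have h := (hasDerivWithinAt_integral_mul_consState_apply hρc huc hθc ht hχ k hκ).differentiableWithinAt
      rw [show G = fun κ' => ∫ x, χ x * (consState (ρ κ' t x) (u κ' t x) (θ κ' t x)) k from funext hGeq]
      exact h
    exact tendstoUniformlyOn_cov_of_tendsto_integral ha hθs hus ha0 hθ0 σ Φ hprobM hFm hCχ0 hFb hG hmean hequi
  refine ⟨?_, fun j => ?_, ?_⟩
  · -- density
    have h := core (fun N z => empiricalDensityField z χ) (fun κ => ∫ x, χ x * ρ κ t x) 0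
      (fun N => continuous_empiricalDensityField hχ)
      (fun N z hz => abs_empiricalDensityField_flow_le (Φ N) hCχ t hz)
      (fun κ => by simp [consState]) hMd hEd
    simpa using h
  · -- momentum, coordinate `j`
    have h := core (fun N z => empiricalMomentumField z χ j) (fun κ => ∫ x, χ x * ρ κ t x * u κ t x j)
      (HsState.momentumIdx j)
      (fun N => (continuous_apply j).comp
        ((PiLp.continuous_ofLp 2 _).comp (continuous_empiricalMomentumField hχ)))
      (fun N z hz => abs_empiricalMomentumField_flow_apply_le (Φ N) hCχ t j hz)
      (fun κ => by simp [consState, mul_assoc]) (hMm j) (hEm j)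
    simpa using h
  · -- energy
    have h := core (fun N z => empiricalEnergyField z χ)
      (fun κ => ∫ x, χ x * totalEnergyDensity (ρ κ t x) (u κ t x) (θ κ t x)) 4
      (fun N => continuous_empiricalEnergyField hχ)
      (fun N z hz => abs_empiricalEnergyField_flow_le (Φ N) hCχ t hz)
      (fun κ => by simp [consState]) hMe hEe
    simpa using h

end Summit.AtomisticToContinuum.HydrodynamicLimit.Theorems.AscoliMeanDoor

end
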